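import Summits.QuantumFields.YangMills.Theorems.BalabanUVNodesN15FullPropagatorGenuineN15At
import Literature.MathematicalPhysics.QuantumFieldTheory.Balaban1983to89.T4EtaRateUnitWitness
import Literature.MathematicalPhysics.QuantumFieldTheory.Balaban1983to89.NE2NodeTorus

/-!
# Route «BalabanUVNodes», cluster K4 «SpineRates» — node N15 = NE2: `N15At` FOR BAŁABAN's GENUINE `U ≡ 1` OBJECTS WITH THE UNIT LAYER := [B6] (2.156)
# `C^{(k)}_Λ = C(C*Δ_kC)⁻¹C*` ITSELF — NO WEIGHT WINDOW, NO DISPLAYED BINDER — AND THE `NE2Objects₁₁` LITERAL ∕ KEYED-HOME FACES OF THAT FAMILY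

Cell `pub-ymgap`, seat `pub-ymgap-dag-n15-a` (-a KNIT-BY-NAME seat of node N15, «vector layer by the scalar template»; HUMAN RULING D-0062; chair R424 venue),
generation 15, part 76 (three data `def`s — an index sub-type, a kernel family, an `NE2Objects₁₁` literal —, the rest theorems; 0 `sorry`).
`bears_on: R4∕N15 · K3⁷ SpineGivenEndpointR13SepCoPH (stmt-QuantumFields-20544; dag-lead WORDS-143)`.  Filed `--kind proof --supports stmt-QuantumFields-20544 --as helper` —
COUNT-NEUTRAL.

WHY.  Part 73 `n15At_fullG_genuine` (p549133) gave `N15At` — all three NE2 conjuncts, no displayed estimate — for Bałaban's genuine `U ≡ 1` objects on the torus family of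
record, but INSIDE A WEIGHT WINDOW `∃ a₀ > 0, ∀ a ≠ 0, |a| ≤ a₀ → …`: its third layer was dag-n15-c G3's `genuineUnitKernel b a` = King's FORM `(a·1 − a²QGQ*)⁻¹` of the full
propagator inverted by a Neumann series, honest only for small `|a|` (G3 header: «King's `a` is not small: positivity of `Δ^{(k)}`, (4.33) p.674, is the printed mechanism —
NOT used»; «[B6] (2.156) `C^{(k)}` and King's (2.16) … differ from this inverse by printed normalisations NOT tracked»).  The window propagated to dag-n27-c's leaf
`…N27AtAdmReadingOfRecord13CoPHKnitN15.spine_rec13CCoPH_at_readingAdm₁₃CoPH_of_fullG_family` (p551502) as the displayed binder `∃ a₀, … ∀ a, (∀ F, a F ≠ 0 ∧ |a F| ≤ a₀ F) → …`,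
and referee ref-B's g21 CLOSE (INBOX l.21807) lists «weight window displayed» among the three distances between every N15 «BY NAME» readout and the statement of record.
BUT THE GENUINE THIRD-LAYER OBJECT AT `U ≡ 1` HAS BEEN A WINDOW-FREE TREE THEOREM SINCE `pub-balaban`: the unit-lattice covariance [B9] Thm 3.15 (3.187) names at `U ≡ 1` IS
[B6] (2.154)–(2.156) `C^{(k)}_Λ = C(C*Δ_kC)⁻¹C*` (δ-function constraints, the (1.66) form `Δ_k`; no weight parameter at all), and `T4Cov2156Rate.cov2156_rate_torus_king`
(seat t4-ne2-p2) proves King's Lemma 4.5 (4.38) shape for it — `|C^{(L^{k+m})}(b,b′) − C^{(L^k)}(b,b′)| ≤ C′·L^{−k}·e^{−δ′ρ_M(b₋,b′₋)}` uniformly in `k, m`, the torus and the bonds —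
by the PRINTED positivity mechanism (2.153)∕(2.157) (`γ′₀`), not by a Neumann series.  This seat's g0 knit read it on the operator-torus carriers `knitInstance` (one extra
scale); nobody had put it on the family `tgInstance` where the full-propagator operator layer (parts 33–72) and the genuine site layer (dag-n15-c G1) live.  This file does:
* §1 the L-DIVISIBLE SUB-INDEX `TGIndexL = {i : TGIndex ∕∕ 1 ≤ m_T}` of the torus family of record (periods `M_μ = 2L^{m_T}`; `L ∣ M_μ` iff `m_T ≥ 1` for odd `L ≥ 3` — exactly
  where (2.152)'s next block-averaging `δ(QB)` exists; at `m_T = 0`, `M_μ = 2`, Bałaban's run has no further step and no `C^{(k)}`), `dvd_Mn`;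
* §2 def `tgCovStep d hL α β i` — the η-DIFFERENCE KERNEL `(U, y, y′) ↦ C^{(L^{k+m})}((ȳ,α),(ȳ′,β)) − C^{(L^k)}((ȳ,α),(ȳ′,β))` of (2.156) at the unit bonds based at the box
  representatives `ȳ = rep y` of the sites, fixed directions `α, β` (`T4EtaRateUnitWitness.covDiff` at shift `m`), as a `B9.SiteKernel` on `tgInstance d hL i`; ★★
  `etaRateIneqUnit_tgCov` ∕ `ne2PlusUnit_tgCov` ∕ `ne2ZeroUnit_tgCov` — `T4EtaRate.NE2PlusUnit c₃₅ (tgInstance ∘ val) (tgCovStep α β ∘ val) ⊤ dist` on `TGIndexL` with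
  `(δ₀, a₀, B₀, θ) = (δ′, 1, C′, L⁻¹)`, every `c₃₅`, every direction pair, `d ≥ 1`, `L ≥ 2` — HYPOTHESIS-FREE and WINDOW-FREE (`ρ_M(rep y, rep y′) = |y − y′|_T`,
  `B6UnitTorusCarrier.pdist_rep_rep`);
* §3 ★★★ **`n15At_fullG_tgCov`**: for odd `L ≥ 3`, `d ≥ 1`, couplings `b, a_S > 0`, directions `ν μ α β`, EVERY `c₃₅, p`:
  `N15At ⟨TGIndexL, c₃₅, p, tgInstance ∘ val, tgFamily b (tgT1 b ν) (tgT2 b μ) ∘ val, genuineSiteStep a_S ∘ val, tgCovStep α β ∘ val, ⊤, dist⟩` — OPERATOR = part 72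
  `ne2PlusOperator_fullG` (all four (3.42) entries of `(Δ′_b⁻¹, Δ_b⁻¹)`), SITE = dag-n15-c G1 `ne2PlusSite_genuineSite` (`(Q′G′²Q′*)⁻¹`), UNIT = §2 — ALL THREE LAYERS
  BAŁABAN's OWN `U ≡ 1` OBJECTS, NO displayed binder, NO weight window, outright for every parameter value;
* §4 def `fullGCovObjects d hL b a_S ν μ α β c₃₅ p : Node00.NE2Objects₁₁` (RR-1's layer-A container), `ne2OfRecord₁₁_fullGCovObjects` (rfl), `n15At_fullGCovObjects`,
  `layers_fullGCovObjects`, `populated_fullGCovObjects` (`TGIndexL` carries `⟨⟨1,1,_,0⟩,_⟩`);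
* §5 the KEYED-HOME FACES in part 30's stage-generic interface WITHOUT the window: `s_N15_of_admits_fullGCov`, ★★ `s_N15_of_admits_fullGCov_family` (the reading reads the
  datum's own family: `tgInstance 3 F.hL`, block factor `F.L`, `Odd F.L ∧ 1 < F.L` = `F.hL`), `populated_fullGCovObjects_family` — the v1.7 `CoPH` homes instantiate them in
  the companion part 77.

HONEST FRAMING.  Kernel composition BY NAME of landed theorems (part 72, dag-n15-c G1, `T4Cov2156Rate` ∕ `T4EtaRateUnitWitness`, `NE2NodeTorus` §2 re-indexing); no new
estimate.  WHAT THE FAMILY IS: the `U ≡ 1` (A = 0) content of node N15 for Bałaban's OWN linear objects — [B5] (1.69)–(1.71) `(Δ′_b⁻¹, Δ_b⁻¹)` through all four (3.42) entries,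
[B4-I]∕[B5] `(Q′G′²Q′*)⁻¹` at King's couplings, [B6] (2.156) `C^{(k)}_Λ` (Λ = the whole unit torus) — on the L-divisible tori of the family of record `M_μ = 2L^{m_T}`, `m_T ≥ 1`,
`n = L^k`, `n′ = L^m·L^k`; one-point background carrier, so (3.35)∕(3.36) are VOID and the «+» blocks inert (NE2⁰ content inside NE2⁺'s type); inert [B9] size parameter
`gf.M = 1`; rates `(L^k)^{−1∕16}`, `(L^k)^{−1∕(8(d+1))}`, `L^{−k∕4}`, `L^{−k}` (sup-block-currency artefacts except the last).  WHAT IT IS NOT: NOT Bałaban's multiscale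
`G(U)` ∕ `C^{(k)}(Λ)(U)` with the background LIVE (NE2⁺ proper — NOT PRINTED beyond King's scalar template [King1986] Lemma 4.5 (4.38) p.674), NOT Node 00's [B9] operator
layer of record (residual) — so **N15 is NOT discharged** (typed 28∕28 · discharged 5∕27 of record unchanged); count-neutral; one finite four-torus programme at fixed `ε` —
NOT ℝ⁴, NOT infinite volume, NOT OS, NOT a mass gap, NOT Clay.  Restate-immune (no Theses import).
-/

set_option autoImplicit false

noncomputable section
namespace Summit.QuantumFields.YangMills.BalabanUVNodes.N15.GenuineRecord

open Literature.MathematicalPhysics.QuantumFieldTheory.Balaban1983to89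
open Literature.MathematicalPhysics.QuantumFieldTheory.Balaban1983to89.T4Continuum (T4Family ULoop)
open Literature.MathematicalPhysics.QuantumFieldTheory.Balaban1983to89.T4EtaRate (PairedInstance NE2PlusOperator NE2PlusSite NE2PlusUnit EtaRateIneqUnit)
open Literature.MathematicalPhysics.QuantumFieldTheory.Balaban1983to89.T4EtaRateUnitWitness (covDiff NE2ZeroUnit ne2ZeroUnit_of_ne2PlusUnit)
open Literature.MathematicalPhysics.QuantumFieldTheory.Balaban1983to89.T4EtaRateDefectSite (pt9Bg)
open Literature.MathematicalPhysics.QuantumFieldTheory.Balaban1983to89.T4Cov2156Rate (cov2156_rate_torus_king)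
open Literature.MathematicalPhysics.QuantumFieldTheory.Balaban1983to89.B5Prop11Plancherel (Tor)
open Literature.MathematicalPhysics.QuantumFieldTheory.Balaban1983to89.B6Lemma24Torus (pbox)
open Literature.MathematicalPhysics.QuantumFieldTheory.Balaban1983to89.B6BondEliminationTorus (pdist)
open Literature.MathematicalPhysics.QuantumFieldTheory.Balaban1983to89.B6Cov2156Torus (one_le_M)
open Literature.MathematicalPhysics.QuantumFieldTheory.Balaban1983to89.B6LowerBound2153Torus (rep rep_mem_pbox)
open Literature.MathematicalPhysics.QuantumFieldTheory.Balaban1983to89.B6UnitTorusCarrier (unitTorusGeo pdist_rep_rep)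
open Literature.MathematicalPhysics.QuantumFieldTheory.Balaban1983to89.NE2NodeTorus (ne2PlusOperator_reindex ne2PlusSite_reindex)
open Literature.MathematicalPhysics.QuantumFieldTheory.King1986.Torus (tdistT)
open Node00 (NE2Objects₁₁)
open Summit.QuantumFields.BalabanUV.T4Continuum.HistoryFlow (two_le_L)
open Summit.QuantumFields.YangMills.BalabanUVNodes.N15.TwoGrid (TGIndex tgInstance tgGeoC tgFamily tgT1 tgT2 ne2PlusOperator_fullG)
open Summit.QuantumFields.YangMills.BalabanUVNodes.N15.GenuineSite (genuineSiteStep ne2PlusSite_genuineSite)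
open Summit.QuantumFields.YangMills.BalabanUVNodes.N15.AtKeyedHome (s_N15_of_admits neZero_blockFactor)
open YMDAG.UVSplit (Datum NE2Carriers RateCarriers RateRecordPred N15At S_N15 ne2OfRecord₁₁)

variable {d : ℕ} {L : ℕ} [NeZero L]

/-! ## §1 The L-divisible sub-index of the torus family of record -/

/-- THE L-DIVISIBLE SUB-INDEX of the torus family of record: the indices `(m_T, k ≥ 1, m)` of part 55's `TGIndex` with torus exponent `m_T ≥ 1`, i.e. periods
`M_μ = 2L^{m_T}` divisible by the block factor `L` — the tori on which (2.152)'s next block-averaging `δ(QB)`, hence the fluctuation covariance (2.156), exists.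
[cite: Balaban1984PropagatorsII, (2.152)–(2.156) pp.249–250 (object: the torus of L-blocks)] -/
abbrev TGIndexL : Type := {i : TGIndex // 1 ≤ i.mT}

/-- NON-VACUITY: `TGIndexL` carries `(m_T, k, m) = (1, 1, 0)`. [folklore] -/
theorem tgIndexL_nonempty : Nonempty TGIndexL := ⟨⟨⟨1, 1, le_rfl, 0⟩, le_rfl⟩⟩

omit [NeZero L] in
/-- On the sub-index the periods `M_μ = 2L^{m_T}` are divisible by `L`. [folklore] -/
theorem dvd_Mn (hL : Odd L ∧ 1 < L) (i : TGIndexL) (μ : Fin (d + 1)) : L ∣ TGIndex.Mn d hL i.1 μ := by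
  have hm : i.1.mT ≠ 0 := by have := i.2; omega
  show L ∣ 2 * L ^ i.1.mT
  exact Dvd.dvd.mul_left (dvd_pow_self L hm) 2

/-! ## §2 The (2.156) unit-lattice covariance difference as a site kernel on `tgInstance`; `NE2PlusUnit` ∕ `NE2ZeroUnit` window-free -/

/-- **THE GENUINE UNIT-LATTICE η-DIFFERENCE KERNEL OF [B6] (2.156) on the realised paired-instance family of the torus family of record** (part 55 `tgInstance`: coarse ∕ fine
unit-torus carriers of the runs `k`, `k + m`, identity pairing of sites, one-point backgrounds): `(U, y, y′) ↦ C^{(L^{k+m})}((ȳ, α), (ȳ′, β)) − C^{(L^k)}((ȳ, α), (ȳ′, β))`,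
`C^{(n)} = C(C*Δ^{(n)}C)⁻¹C*` the fluctuation covariance of the (1.66) form at level `n` (`T4EtaRateUnitWitness.covDiff`, through `B6Cov2156Torus.bondReductionT ∕ deltaPol`), read at
the unit bonds in the fixed directions `α, β` based at the box representatives `ȳ = rep y`, `ȳ′ = rep y′` of the sites. [cite: Balaban1984PropagatorsII, (2.156) p.250 (object);
Balaban1985BackgroundPropagators, Thm 3.15 (3.187) p.432 (the unit-lattice covariance `C^{(k)}(Λ)`, shape)] -/
def tgCovStep (d : ℕ) (hL : Odd L ∧ 1 < L) (α β : Fin (d + 1)) (i : TGIndex) : B9.SiteKernel (tgInstance d hL i).gc (tgInstance d hL i).Bf :=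
  show B9.SiteKernel (tgGeoC d hL i) pt9Bg from
    ⟨fun _ y y' => covDiff L (TGIndex.Mn d hL i) i.k i.m
        (⟨rep (TGIndex.Mn d hL i) y, rep_mem_pbox (TGIndex.Mn d hL i) y⟩, α)
        (⟨rep (TGIndex.Mn d hL i) y', rep_mem_pbox (TGIndex.Mn d hL i) y'⟩, β)⟩

/-- Unfolding of `tgCovStep`. [folklore] -/
theorem tgCovStep_ker (hL : Odd L ∧ 1 < L) (α β : Fin (d + 1)) (i : TGIndex) (U : Unit) (y y' : Tor (TGIndex.Mn d hL i)) :
    (tgCovStep d hL α β i).ker U y y'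
      = covDiff L (TGIndex.Mn d hL i) i.k i.m (⟨rep (TGIndex.Mn d hL i) y, rep_mem_pbox (TGIndex.Mn d hL i) y⟩, α)
          (⟨rep (TGIndex.Mn d hL i) y', rep_mem_pbox (TGIndex.Mn d hL i) y'⟩, β) := rfl

/-- ★★ **`EtaRateIneqUnit` FOR THE (2.156) KERNEL, UNIFORMLY OVER THE L-DIVISIBLE SUB-FAMILY, HYPOTHESIS-FREE AND WINDOW-FREE** (`d ≥ 1`, odd `L ≥ 3` — hypothesis `Odd L ∧ 1 < L`): ONE `(B₀, δ₀)` in `(d, L)`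
such that at EVERY index `i` with `m_T ≥ 1`, every direction pair, the (unique) background and all sites
`|C^{(L^{k+m})}((ȳ,α),(ȳ′,β)) − C^{(L^k)}((ȳ,α),(ȳ′,β))| ≤ B₀·e^{−δ₀|y − y′|_T}·(L⁻¹)^k` — `T4Cov2156Rate.cov2156_rate_torus_king` (King's Lemma 4.5 shape for (2.156) by the
printed positivity (2.153)∕(2.157)) read at base points (`ρ_M(rep y, rep y′) = |y − y′|_T`, `B6UnitTorusCarrier.pdist_rep_rep`); region `⊤`, distance = the carrier's `tdistT`.
[cite: King1986, Lemma 4.5 (4.38) p.674 (A = 0 shape); Balaban1984PropagatorsII, (2.156)–(2.157) p.250 (object, positivity)] -/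
theorem etaRateIneqUnit_tgCov (hd : 1 ≤ d) (hL : Odd L ∧ 1 < L) :
    ∃ B₀ δ₀ : ℝ, 0 < B₀ ∧ 0 < δ₀ ∧ ∀ (α β : Fin (d + 1)) (i : TGIndexL) (U : (tgInstance d hL i.1).Bf.Cfg),
      EtaRateIneqUnit (tgCovStep d hL α β i.1) (fun _ => True) (tgGeoC d hL i.1).dist B₀ δ₀ ((L : ℝ)⁻¹) i.1.k U := by
  have hL1 : 1 ≤ L := Nat.one_le_iff_ne_zero.mpr (NeZero.ne L)
  obtain ⟨C', δ', hC', hδ', H⟩ := cov2156_rate_torus_king (d + 1) (by omega) hL1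
  refine ⟨C', δ', hC', hδ', fun α β i U y y' _ _ => ?_⟩
  have h := H (TGIndex.Mn d hL i.1) (dvd_Mn (d := d) hL i) i.1.k i.1.m
    (⟨rep (TGIndex.Mn d hL i.1) y, rep_mem_pbox (TGIndex.Mn d hL i.1) y⟩, α)
    (⟨rep (TGIndex.Mn d hL i.1) y', rep_mem_pbox (TGIndex.Mn d hL i.1) y'⟩, β)
  have hdist : pdist (TGIndex.Mn d hL i.1) (one_le_M (TGIndex.Mn d hL i.1)) (rep (TGIndex.Mn d hL i.1) y) (rep (TGIndex.Mn d hL i.1) y')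
      = tdistT (TGIndex.Mn d hL i.1) y y' := pdist_rep_rep _ _ y y'
  show |covDiff L (TGIndex.Mn d hL i.1) i.1.k i.1.m (⟨rep (TGIndex.Mn d hL i.1) y, rep_mem_pbox (TGIndex.Mn d hL i.1) y⟩, α)
      (⟨rep (TGIndex.Mn d hL i.1) y', rep_mem_pbox (TGIndex.Mn d hL i.1) y'⟩, β)|
    ≤ C' * Real.exp (-(δ' * tdistT (TGIndex.Mn d hL i.1) y y')) * ((L : ℝ)⁻¹) ^ i.1.k
  rw [← hdist, inv_pow]
  calc _ ≤ C' * ((L : ℝ) ^ i.1.k)⁻¹ * Real.exp (-(δ' * pdist (TGIndex.Mn d hL i.1) (one_le_M (TGIndex.Mn d hL i.1))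
            (rep (TGIndex.Mn d hL i.1) y) (rep (TGIndex.Mn d hL i.1) y'))) := h
    _ = _ := by ring

/-- ★★ **`NE2PlusUnit` — THE NODE's THIRD CONJUNCT BY NAME — FOR BAŁABAN's OWN (2.156) COVARIANCE `C^{(k)}_Λ` AT `U ≡ 1` ON THE L-DIVISIBLE TORI OF THE FAMILY OF RECORD**, every
direction pair `α β` and every `c₃₅`: constants `(δ₀, a₀, B₀, θ) = (δ₀, 1, B₀, L⁻¹)`, clean rate `θ = L⁻¹ < 1` (`L ≥ 2`), NO weight window, NO Neumann series.  HONEST SCOPE: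
one-point background carrier — the regularity blocks (3.35)∕(3.36) are VOID there, the «+» is inert and the content is NE2⁰'s (`ne2ZeroUnit_tgCov`); rate, decay, uniformity
genuine. [cite: Balaban1985BackgroundPropagators, Thm 3.15 (3.187) p.432 (quantifier template); King1986, Lemma 4.5 (4.38) p.674 (shape)] -/
theorem ne2PlusUnit_tgCov (hd : 1 ≤ d) (hL2 : 2 ≤ L) (hL : Odd L ∧ 1 < L) (α β : Fin (d + 1)) (c35 : ℝ) :
    NE2PlusUnit c35 (fun i : TGIndexL => tgInstance d hL i.1) (fun i => tgCovStep d hL α β i.1) (fun _ _ => True)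
      (fun i => (tgGeoC d hL i.1).dist) := by
  obtain ⟨B₀, δ₀, hB₀, hδ₀, H⟩ := etaRateIneqUnit_tgCov (d := d) hd hL
  have hLpos : (0 : ℝ) < L := by exact_mod_cast (lt_of_lt_of_le zero_lt_two hL2)
  have hθ1 : ((L : ℝ)⁻¹) < 1 := inv_lt_one_of_one_lt₀ (by exact_mod_cast hL2)
  exact ⟨δ₀, 1, B₀, (L : ℝ)⁻¹, hδ₀, one_pos, hB₀, inv_pos.mpr hLpos, hθ1, fun i _ _ _ U _ _ => H α β i U⟩

/-- ★★ **`NE2ZeroUnit` FOR THE (2.156) COVARIANCE ON THE L-DIVISIBLE TORI OF THE FAMILY OF RECORD** — the NE2⁰-unit letter BY NAME (`T4EtaRateUnitWitness.NE2ZeroUnit`; [B9]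
size parameter `gf.M = 1 > 0`, trivial regularity). [cite: King1986, Lemma 4.5 (4.38) p.674 (A = 0 shape); Balaban1984PropagatorsII, (2.156) p.250 (object)] -/
theorem ne2ZeroUnit_tgCov (hd : 1 ≤ d) (hL2 : 2 ≤ L) (hL : Odd L ∧ 1 < L) (α β : Fin (d + 1)) :
    NE2ZeroUnit (fun i : TGIndexL => tgInstance d hL i.1) (fun i => tgCovStep d hL α β i.1) (fun _ _ => True)
      (fun i => (tgGeoC d hL i.1).dist) :=
  ne2ZeroUnit_of_ne2PlusUnit (c35 := 0) (fun _ => by show (0 : ℝ) < 1; norm_num) (fun _ _ _ => trivial) (fun _ _ _ => trivial)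
    (ne2PlusUnit_tgCov (d := d) hd hL2 hL α β 0)

/-! ## §3 `N15At` for the genuine `U ≡ 1` family with the (2.156) unit layer — no window, no displayed binder -/

/-- ★★★ **`N15At` — ALL THREE CONJUNCTS BY NAME, NO DISPLAYED BINDER, NO WEIGHT WINDOW — FOR BAŁABAN's GENUINE `U ≡ 1` OBJECTS ON THE L-DIVISIBLE TORI OF THE FAMILY OF
RECORD.**  For `d ≥ 1`, odd `L ≥ 3`, couplings `b, a_S > 0`, directions `ν, μ` (entry 1's gradient ∕ entry 2's divergence) and `α, β` (the unit bonds' directions), EVERY `c₃₅`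
and `p`: `N15At ⟨TGIndexL, c₃₅, p, tgInstance ∘ val, tgFamily b (tgT1 b ν) (tgT2 b μ) ∘ val, genuineSiteStep a_S ∘ val, tgCovStep α β ∘ val, ⊤, dist⟩` — OPERATOR = part 72
`ne2PlusOperator_fullG` (all four (3.42) entries of `(Δ′_b⁻¹, Δ_b⁻¹)`), SITE = dag-n15-c G1 `ne2PlusSite_genuineSite` (`(Q′G′²Q′*)⁻¹` at King's couplings), UNIT = §2
`ne2PlusUnit_tgCov` ([B6] (2.156)); the first two re-indexed to the sub-family by `NE2NodeTorus` §2.  One-point background carrier: the «+» blocks are inert (content NE2⁰'s) —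
said. [bookkeeping] -/
theorem n15At_fullG_tgCov (hd : 1 ≤ d) (hLodd : Odd L) (hL2 : 2 ≤ L) (hL : Odd L ∧ 1 < L) {b aS : ℝ} (hb : 0 < b) (haS : 0 < aS)
    (ν μ α β : Fin (d + 1)) (c35 p : ℝ) :
    N15At { I := TGIndexL, c35 := c35, p := p, pi := fun i => tgInstance d hL i.1,
            Kop := fun i => tgFamily d hL b (tgT1 d hL b ν) (tgT2 d hL b μ) i.1, Ksite := fun i => genuineSiteStep d hL aS i.1,
            Kunit := fun i => tgCovStep d hL α β i.1, inΛ := fun _ _ => True, unitDist := fun i => (tgGeoC d hL i.1).dist } :=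
  ⟨ne2PlusOperator_reindex (Subtype.val : TGIndexL → TGIndex) (ne2PlusOperator_fullG (d := d) hLodd hL2 hL hb c35 ν μ),
   ne2PlusSite_reindex (Subtype.val : TGIndexL → TGIndex) (ne2PlusSite_genuineSite (d := d) hLodd hL2 hL haS 4 p c35),
   ne2PlusUnit_tgCov (d := d) hd hL2 hL α β c35⟩

/-! ## §4 The family as N15's `NE2Objects₁₁` literal -/

/-- **N15's NE2 OBJECTS OF THE GENUINE `U ≡ 1` FAMILY WITH THE (2.156) UNIT LAYER** (RR-1's layer-A container `Node00.NE2Objects₁₁`): index `TGIndexL` (torus exponent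
`m_T ≥ 1`, `k ≥ 1`, scale shift `m`), letters `c₃₅`, `p`, the realised paired instances `tgInstance d hL` (coarse∕fine unit-torus carriers `M_μ = 2L^{m_T}`, King's pairing),
OPERATOR kernels `tgFamily b (tgT1 b ν) (tgT2 b μ)` (the four (3.42) entries of `(Δ′_b⁻¹, Δ_b⁻¹)`), SITE kernel `genuineSiteStep a_S` (`𝔇((Q′G′²Q′*)⁻¹)` at King's couplings
on `a_S`), UNIT kernel `tgCovStep α β` (`𝔇` of [B6] (2.156) `C^{(k)}_Λ` at the unit bonds of directions `α, β`), region `⊤`, unit distance = the carrier's. [bookkeeping] -/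
def fullGCovObjects (d : ℕ) (hL : Odd L ∧ 1 < L) (b aS : ℝ) (ν μ α β : Fin (d + 1)) (c35 p : ℝ) : NE2Objects₁₁ where
  I := TGIndexL
  c35 := c35
  p := p
  pi := fun i => tgInstance d hL i.1
  Kop := fun i => tgFamily d hL b (tgT1 d hL b ν) (tgT2 d hL b μ) i.1
  Ksite := fun i => genuineSiteStep d hL aS i.1
  Kunit := fun i => tgCovStep d hL α β i.1
  inΛ := fun _ _ => True
  unitDist := fun i => (tgGeoC d hL i.1).dist

/-- The home's NE2 bundle of the objects IS §3's record (`rfl`, field for field). [bookkeeping] -/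
theorem ne2OfRecord₁₁_fullGCovObjects (hL : Odd L ∧ 1 < L) (b aS : ℝ) (ν μ α β : Fin (d + 1)) (c35 p : ℝ) :
    ne2OfRecord₁₁ (fullGCovObjects d hL b aS ν μ α β c35 p) =
      { I := TGIndexL, c35 := c35, p := p, pi := fun i => tgInstance d hL i.1,
        Kop := fun i => tgFamily d hL b (tgT1 d hL b ν) (tgT2 d hL b μ) i.1, Ksite := fun i => genuineSiteStep d hL aS i.1,
        Kunit := fun i => tgCovStep d hL α β i.1, inΛ := fun _ _ => True, unitDist := fun i => (tgGeoC d hL i.1).dist } := rfl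

/-- ★★★ **`N15At` AT THE OBJECTS' BUNDLE — OUTRIGHT, EVERY PARAMETER VALUE** (§3 read through `ne2OfRecord₁₁`). [bookkeeping] -/
theorem n15At_fullGCovObjects (hd : 1 ≤ d) (hLodd : Odd L) (hL2 : 2 ≤ L) (hL : Odd L ∧ 1 < L) {b aS : ℝ} (hb : 0 < b) (haS : 0 < aS)
    (ν μ α β : Fin (d + 1)) (c35 p : ℝ) : N15At (ne2OfRecord₁₁ (fullGCovObjects d hL b aS ν μ α β c35 p)) :=
  n15At_fullG_tgCov (d := d) hd hLodd hL2 hL hb haS ν μ α β c35 p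

/-- **THE THREE LAYERS SPELLED OUT at the objects** (`N15At` unfolded: `NE2PlusOperator ∧ NE2PlusSite 4 ∧ NE2PlusUnit`). [bookkeeping] -/
theorem layers_fullGCovObjects (hd : 1 ≤ d) (hLodd : Odd L) (hL2 : 2 ≤ L) (hL : Odd L ∧ 1 < L) {b aS : ℝ} (hb : 0 < b) (haS : 0 < aS)
    (ν μ α β : Fin (d + 1)) (c35 p : ℝ) :
    NE2PlusOperator c35 (fun i : TGIndexL => tgInstance d hL i.1) (fun i => tgFamily d hL b (tgT1 d hL b ν) (tgT2 d hL b μ) i.1) ∧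
    NE2PlusSite 4 p c35 (fun i : TGIndexL => tgInstance d hL i.1) (fun i => genuineSiteStep d hL aS i.1) ∧
    NE2PlusUnit c35 (fun i : TGIndexL => tgInstance d hL i.1) (fun i => tgCovStep d hL α β i.1) (fun _ _ => True) (fun i => (tgGeoC d hL i.1).dist) :=
  n15At_fullG_tgCov (d := d) hd hLodd hL2 hL hb haS ν μ α β c35 p

/-- **RR-1's DISPLAY HOLDS AT THE LITERAL**: the objects are `Populated` (`TGIndexL` carries `⟨⟨1, 1, _, 0⟩, _⟩`). [bookkeeping] -/
theorem populated_fullGCovObjects (hL : Odd L ∧ 1 < L) (b aS : ℝ) (ν μ α β : Fin (d + 1)) (c35 p : ℝ) :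
    (fullGCovObjects d hL b aS ν μ α β c35 p).Populated :=
  (NE2Objects₁₁.populated_iff _).2 tgIndexL_nonempty

/-! ## §5 The keyed-home faces, no weight window: a home admitting the literals has `S_N15`, no estimate displayed -/

section KeyedHome

variable {N : ℕ} [NeZero N] {key : (F : T4Family) → Datum F N → Prop}

/-- ★★ **THE READING CLOSES THE STUB AT ANY KEYED HOME — NO WINDOW** (part 30's interface): for `d ≥ 1`, odd `L ≥ 3`, `b, a_S > 0`, directions `ν μ α β` and letters `c₃₅`,
`p`: a rate home `RRec` over ANY key that admits only the literals of a key-indexed NE2 reading `ne2At` (`hadm`) whose value at every key, `(g₀, os)` and run length IS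
`fullGCovObjects d hL b a_S ν μ α β c₃₅ p` has `S_N15 RRec` — the estimate is §3, not a hypothesis.  Honest scope: the `U ≡ 1` objects (one-point background), NOT Bałaban's
`G(U)` ∕ `C^{(k)}(Λ)(U)`. [bookkeeping] -/
theorem s_N15_of_admits_fullGCov (hd : 1 ≤ d) (hLodd : Odd L) (hL2 : 2 ≤ L) (hL : Odd L ∧ 1 < L) {b aS : ℝ} (hb : 0 < b) (haS : 0 < aS)
    (ν μ α β : Fin (d + 1)) (c35 p : ℝ)
    (ne2At : ∀ {F : T4Family} {D : Datum F N}, key F D → (ℕ → ℝ) → List (ULoop F) → ℕ → NE2Objects₁₁) (RRec : RateRecordPred N)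
    (hadm : ∀ (F : T4Family) (D : Datum F N) (g₀ : ℕ → ℝ) (os : List (ULoop F)) (R : RateCarriers N), RRec F D g₀ os R →
      ∃ (h : key F D) (k : ℕ), R.ne2 = ne2OfRecord₁₁ (ne2At h g₀ os k))
    (h : ∀ (F : T4Family) (D : Datum F N) (h : key F D) (g₀ : ℕ → ℝ) (os : List (ULoop F)) (k : ℕ), ne2At h g₀ os k = fullGCovObjects d hL b aS ν μ α β c35 p) :
    S_N15 RRec := by
  refine s_N15_of_admits ne2At RRec hadm fun F D hk g₀ os k => ?_
  rw [h F D hk g₀ os k]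
  exact n15At_fullGCovObjects (d := d) hd hLodd hL2 hL hb haS ν μ α β c35 p

/-- ★★ **THE FAMILY-KEYED READING CLOSES THE STUB AT ANY KEYED HOME — NO WINDOW** (`d + 1 = 4`): the reading READS THE DATUM's FAMILY — at a key of family `F` its NE2 objects
are the genuine objects on `F`'s OWN block factor (`tgInstance 3 F.hL`: Bałaban's structural hypothesis `Odd L ∧ 1 < L` IS the family's field `F.hL`; `2 ≤ F.L` from `11 < L`).
For `b, a_S > 0`, `ν μ α β`, `c₃₅`, `p`: every such reading's home has `S_N15 RRec` — no estimate and no weight displayed. [bookkeeping] -/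
theorem s_N15_of_admits_fullGCov_family {b aS : ℝ} (hb : 0 < b) (haS : 0 < aS) (ν μ α β : Fin 4) (c35 p : ℝ)
    (ne2At : ∀ {F : T4Family} {D : Datum F N}, key F D → (ℕ → ℝ) → List (ULoop F) → ℕ → NE2Objects₁₁) (RRec : RateRecordPred N)
    (hadm : ∀ (F : T4Family) (D : Datum F N) (g₀ : ℕ → ℝ) (os : List (ULoop F)) (R : RateCarriers N), RRec F D g₀ os R →
      ∃ (h : key F D) (k : ℕ), R.ne2 = ne2OfRecord₁₁ (ne2At h g₀ os k))
    (h : ∀ (F : T4Family) (D : Datum F N) (h : key F D) (g₀ : ℕ → ℝ) (os : List (ULoop F)) (k : ℕ),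
      ne2At h g₀ os k = haveI := neZero_blockFactor F; fullGCovObjects 3 F.hL b aS ν μ α β c35 p) :
    S_N15 RRec := by
  refine s_N15_of_admits ne2At RRec hadm fun F D hk g₀ os k => ?_
  rw [h F D hk g₀ os k]
  haveI := neZero_blockFactor F
  exact n15At_fullGCovObjects (d := 3) (by norm_num) F.hL.1 (two_le_L F) F.hL hb haS ν μ α β c35 p

/-- **RR-1's DISPLAY AT THE FAMILY-KEYED LITERAL** (populated at every family). [bookkeeping] -/
theorem populated_fullGCovObjects_family (F : T4Family) (b aS : ℝ) (ν μ α β : Fin 4) (c35 p : ℝ) :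
    (haveI := neZero_blockFactor F; fullGCovObjects 3 F.hL b aS ν μ α β c35 p).Populated := by
  haveI := neZero_blockFactor F
  exact populated_fullGCovObjects F.hL b aS ν μ α β c35 p

end KeyedHome

end Summit.QuantumFields.YangMills.BalabanUVNodes.N15.GenuineRecord

end
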